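import Literature.Probability.Percolation.SlabRSWGluingSegment
import HarnessLib

/-!
# Newman–Tassion–Wu 2017, §3.2 — GL0 (linear regime) in every orientation

Topic: `Literature/Probability/Percolation`. The files `SlabRSWGluingRect.lean` (target `B` a full
side) and `SlabRSWGluingSegment.lean` (target `B` a segment) prove NTW's gluing lemma GL0
(Thm. 3.6, linear regime) with `B` on the RIGHT side of the rectangle — the minimal path `Γ_min`
is taken for the vertex-lexicographic order `vKey`, which is not symmetric. The STATEMENT of GL0
only involves the events `X ⟷^S Y`, whose probabilities are invariant under the planar
symmetries of the slab (the tree's `real_preimage_slabRelabel`, `preimage_slabRelabel_slabConn`: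
translations, the reflections `planarReflect t : (x, y) ↦ (t - x, y)` and the diagonal swap
`planarSwap : (x, y) ↦ (y, x)`). This file transports GL0 to images under such symmetries
(the tree's `real_slabConn_image`; `glueLinear_image`, `glueLinear_seg_image`, with the planar-crossing hypothesis transported by
`PlanarCrossing.of_image`), and spells out the target-on-TOP versions used in §3.3
(`glueLinear_rect_top`: `B` the full top side, `A` on the bottom side, `C`/`D` on the left/right
sides; `glueLinear_seg_top`: `B` a segment of the top side).

## Sources

* C. M. Newman, V. Tassion, W. Wu, *Critical percolation and the minimal spanning tree in slabs*,
  Comm. Pure Appl. Math. 70 (2017), arXiv:1512.09107: §3.2, Theorem 3.6; §3.3 ("Invariance under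
  reflection", "by symmetry") [NewmanTassionWu2017].
-/

noncomputable section

namespace Literature.Probability.Percolation

open MeasureTheory LatticeModels SimpleGraph

namespace NTW17

variable {k : ℕ}

/-! ## Transport of events and of the planar-crossing hypothesis -/

/-- Planar walks are mapped to planar walks by planar symmetries.
[cite: NewmanTassionWu2017, §3.2 (Theorem 3.6, "the projection on ℤ² of any path")] -/
theorem IsPlanarWalk.map {g : ℤ × ℤ ≃ ℤ × ℤ} (hg : ∀ z w, planarAdj (g z) (g w) ↔ planarAdj z w)
    {l : List (ℤ × ℤ)} (h : IsPlanarWalk l) : IsPlanarWalk (l.map g) := by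
  rw [IsPlanarWalk, List.isChain_map]
  refine List.IsChain.imp (fun a b hab => ?_) h
  rcases hab with hab | hab
  · exact Or.inl (by rw [hab])
  · exact Or.inr ((hg a b).2 hab)

/-- **The planar-crossing hypothesis is transported by planar symmetries**: if it holds for the
images, it holds for the original sets. [cite: NewmanTassionWu2017, §3.2 (Theorem 3.6, hypothesis)] -/
theorem PlanarCrossing.of_image {g : ℤ × ℤ ≃ ℤ × ℤ} (hg : ∀ z w, planarAdj (g z) (g w) ↔ planarAdj z w)
    {S A B C D : Set (ℤ × ℤ)} (h : PlanarCrossing (g '' S) (g '' A) (g '' B) (g '' C) (g '' D)) :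
    PlanarCrossing S A B C D := by
  intro l₁ l₂ h₁ h₂ hw₁ hw₂ hS₁ hS₂ hhA hlB hhC hlD
  have hne₁ : l₁.map g ≠ [] := by simpa using h₁
  have hne₂ : l₂.map g ≠ [] := by simpa using h₂
  obtain ⟨z, hz₁, hz₂⟩ := h (l₁.map g) (l₂.map g) hne₁ hne₂ (hw₁.map hg) (hw₂.map hg)
    (fun z hz => by obtain ⟨w, hw, rfl⟩ := List.mem_map.1 hz; exact Set.mem_image_of_mem _ (hS₁ w hw))
    (fun z hz => by obtain ⟨w, hw, rfl⟩ := List.mem_map.1 hz; exact Set.mem_image_of_mem _ (hS₂ w hw))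
    (by rw [List.head_map]; exact Set.mem_image_of_mem _ hhA)
    (by rw [List.getLast_map]; exact Set.mem_image_of_mem _ hlB)
    (by rw [List.head_map]; exact Set.mem_image_of_mem _ hhC)
    (by rw [List.getLast_map]; exact Set.mem_image_of_mem _ hlD)
  obtain ⟨v₁, hv₁, rfl⟩ := List.mem_map.1 hz₁
  obtain ⟨v₂, hv₂, hv⟩ := List.mem_map.1 hz₂
  exact ⟨v₁, hv₁, by rwa [← g.injective hv]⟩

/-- The planar-crossing hypothesis is symmetric in the two pairs.
[cite: NewmanTassionWu2017, §3.2 (Theorem 3.6, hypothesis)] -/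
theorem PlanarCrossing.swap_pairs {S A B C D : Set (ℤ × ℤ)} (h : PlanarCrossing S A B C D) :
    PlanarCrossing S C D A B := by
  intro l₁ l₂ h₁ h₂ hw₁ hw₂ hS₁ hS₂ hhC hlD hhA hlB
  obtain ⟨z, hz₂, hz₁⟩ := h l₂ l₁ h₂ h₁ hw₂ hw₁ hS₂ hS₁ hhA hlB hhC hlD
  exact ⟨z, hz₁, hz₂⟩

/-! ## GL0 for images of the two basic settings -/

/-- **GL0, linear regime, transported** (full-side target): the conclusion of `glueLinear` for the
images of a `RectSetup` under a planar symmetry `g`.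
[cite: NewmanTassionWu2017, §3.2 (Theorem 3.6), §3.3 ("by symmetry")] -/
theorem glueLinear_image (T : RectSetup) (g : ℤ × ℤ ≃ ℤ × ℤ)
    (hg : ∀ z w, planarAdj (g z) (g w) ↔ planarAdj z w) (hk : 1 ≤ k) {ρ : ℕ} (hρ : 2 ≤ ρ)
    (hsep : ∀ a' ∈ T.A, ∀ c' ∈ T.C, c' ∉ sqBox a' (4 * ρ + 8)) {Dd' : Set (ℤ × ℤ)}
    (hcross : PlanarCrossing (g '' T.S) (g '' T.A) (g '' T.B) (g '' T.C) Dd')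
    (p : unitInterval) (hp0 : 0 < (p : ℝ)) (hp1 : (p : ℝ) < 1) :
    (bondPercolation (slabGraph 3 k) p).real (slabConn k (g '' T.S) (g '' T.A) (g '' T.B)) *
        (bondPercolation (slabGraph 3 k) p).real (slabConn k (g '' T.S) (g '' T.C) Dd') ≤
      (1 + (2 / min (p : ℝ) (1 - p)) ^ (3 * ((5 * k + 4) * (2 * (6 * ρ + 4) + 1) ^ 2))) *
        (bondPercolation (slabGraph 3 k) p).real (slabConn k (g '' T.S) (g '' T.C) (g '' T.A)) := by
  have hD : Dd' = g '' (g.symm '' Dd') := by rw [← Set.image_comp]; simp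
  rw [hD] at hcross ⊢
  rw [real_slabConn_image k g hg, real_slabConn_image k g hg, real_slabConn_image k g hg]
  exact glueLinear T hk hρ hsep (hcross.of_image hg) p hp0 hp1

/-- **GL0, linear regime, transported** (segment target).
[cite: NewmanTassionWu2017, §3.2 (Theorem 3.6), §3.3 ("by symmetry")] -/
theorem glueLinear_seg_image (T : SegSetup) (g : ℤ × ℤ ≃ ℤ × ℤ)
    (hg : ∀ z w, planarAdj (g z) (g w) ↔ planarAdj z w) (hk : 1 ≤ k) {ρ : ℕ} (hρ : 4 ≤ ρ)
    (hsep : ∀ a' ∈ T.A, ∀ c' ∈ T.C, c' ∉ sqBox a' (4 * ρ + 8)) {Dd' : Set (ℤ × ℤ)}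
    (hcross : PlanarCrossing (g '' T.S) (g '' T.A) (g '' T.B) (g '' T.C) Dd')
    (p : unitInterval) (hp0 : 0 < (p : ℝ)) (hp1 : (p : ℝ) < 1) :
    (bondPercolation (slabGraph 3 k) p).real (slabConn k (g '' T.S) (g '' T.A) (g '' T.B)) *
        (bondPercolation (slabGraph 3 k) p).real (slabConn k (g '' T.S) (g '' T.C) Dd') ≤
      (1 + (2 / min (p : ℝ) (1 - p)) ^ (3 * ((5 * k + 4) * (2 * (2 * (3 * ρ + 3)) + 1) ^ 2))) *
        (bondPercolation (slabGraph 3 k) p).real (slabConn k (g '' T.S) (g '' T.C) (g '' T.A)) := by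
  have hD : Dd' = g '' (g.symm '' Dd') := by rw [← Set.image_comp]; simp
  rw [hD] at hcross ⊢
  rw [real_slabConn_image k g hg, real_slabConn_image k g hg, real_slabConn_image k g hg]
  exact glueLinear_seg T hk hρ hsep (hcross.of_image hg) p hp0 hp1

/-! ## The diagonal swap: target on the top side -/

/-- The swap maps a rectangle to the transposed rectangle. [cite: NewmanTassionWu2017, §3.3 ("by symmetry")] -/
theorem image_planarSwap_boxR (a b c d : ℤ) : planarSwap '' boxR a b c d = boxR c d a b := by
  ext z
  simp only [Set.mem_image, planarSwap_apply, mem_boxR_iff]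
  constructor
  · rintro ⟨w, hw, rfl⟩
    simp only [Prod.fst_swap, Prod.snd_swap]
    omega
  · intro hz
    refine ⟨z.swap, by simp only [Prod.fst_swap, Prod.snd_swap]; omega, ?_⟩
    simp

/-- The swap exchanges columns and rows. [cite: NewmanTassionWu2017, §3.3 ("by symmetry")] -/
theorem image_planarSwap_eq (X : Set (ℤ × ℤ)) : planarSwap '' X = {z | z.swap ∈ X} := by
  ext z
  simp only [Set.mem_image, planarSwap_apply, Set.mem_setOf_eq]
  constructor
  · rintro ⟨w, hw, rfl⟩; simpa using hw
  · intro hz; exact ⟨z.swap, hz, by simp⟩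

/-- **GL0, linear regime, target the full TOP side**: in `S = [a,b] × [c,d]` (at least four
columns and rows) with `B = [a,b] × {d}`, `A` a subset of the bottom side, `C` a subset of the
left side and `D` of the right side (`glueLinear_rect_top'`: `C` right, `D` left), with
`dist*(A, C) > 4ρ + 8`: `P_p[A ⟷^S B] · P_p[C ⟷^S D] ≤ (1 + λ^s) · P_p[C ⟷^S A]`.
[cite: NewmanTassionWu2017, §3.2 (Theorem 3.6 with Remark 3); §3.3 (Proposition 3.9, X ↔ T(S) glued to L(R) ↔ R(R))] -/
theorem glueLinear_rect_top {a b c d : ℤ} (hab : a + 3 ≤ b) (hcd : c + 3 ≤ d) {A C Dd : Set (ℤ × ℤ)}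
    (hA : ∀ z ∈ A, z ∈ boxR a b c d ∧ z.2 = c) (hC : ∀ z ∈ C, z ∈ boxR a b c d ∧ z.1 = a)
    (hDd : ∀ z ∈ Dd, z.1 = b) (hk : 1 ≤ k) {ρ : ℕ} (hρ : 2 ≤ ρ)
    (hsep : ∀ a' ∈ A, ∀ c' ∈ C, c' ∉ sqBox a' (4 * ρ + 8))
    (p : unitInterval) (hp0 : 0 < (p : ℝ)) (hp1 : (p : ℝ) < 1) :
    (bondPercolation (slabGraph 3 k) p).real
        (slabConn k (boxR a b c d) A {z | z ∈ boxR a b c d ∧ z.2 = d}) *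
        (bondPercolation (slabGraph 3 k) p).real (slabConn k (boxR a b c d) C Dd) ≤
      (1 + (2 / min (p : ℝ) (1 - p)) ^ (3 * ((5 * k + 4) * (2 * (6 * ρ + 4) + 1) ^ 2))) *
        (bondPercolation (slabGraph 3 k) p).real (slabConn k (boxR a b c d) C A) := by
  -- the transposed data: `B` on the right side of `[c,d] × [a,b]`
  have hcd' : c + 3 ≤ d := hcd
  let T : RectSetup :=
    { a := c, b := d, c := a, d := b, A := planarSwap '' A, C := planarSwap '' C,
      hab := hcd', hcd := hab,
      hA := by
        rintro z ⟨w, hw, rfl⟩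
        have := (hA w hw).1
        rw [mem_boxR_iff] at this ⊢
        simp only [planarSwap_apply, Prod.fst_swap, Prod.snd_swap]
        omega
      hC := by
        rintro z ⟨w, hw, rfl⟩
        have := (hC w hw).1
        rw [mem_boxR_iff] at this ⊢
        simp only [planarSwap_apply, Prod.fst_swap, Prod.snd_swap]
        omega
      hAB := by
        rintro z ⟨w, hw, rfl⟩
        have h1 := (hA w hw).1
        have h2 := (hA w hw).2
        rw [mem_boxR_iff] at h1
        simp only [planarSwap_apply, Prod.fst_swap]
        omega }
  have hswap : ∀ z w, planarAdj (planarSwap z) (planarSwap w) ↔ planarAdj z w := planarAdj_planarSwap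
  -- images of the transposed data are the original data
  have hinv : ∀ X : Set (ℤ × ℤ), planarSwap '' (planarSwap '' X) = X := by
    intro X; ext z
    simp only [Set.mem_image, planarSwap_apply]
    constructor
    · rintro ⟨w, ⟨v, hv, rfl⟩, rfl⟩; simpa using hv
    · intro hz; exact ⟨z.swap, ⟨z, hz, rfl⟩, by simp⟩
  have hS : planarSwap '' T.S = boxR a b c d := image_planarSwap_boxR _ _ _ _
  have hA' : planarSwap '' T.A = A := hinv A
  have hC' : planarSwap '' T.C = C := hinv C
  have hB' : planarSwap '' T.B = {z | z ∈ boxR a b c d ∧ z.2 = d} := by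
    rw [image_planarSwap_eq]
    have hTB : T.B = {w | w ∈ boxR c d a b ∧ w.1 = d} := rfl
    rw [hTB]
    ext z
    simp only [Set.mem_setOf_eq, mem_boxR_iff, Prod.fst_swap, Prod.snd_swap]
    omega
  have hsep' : ∀ a' ∈ T.A, ∀ c' ∈ T.C, c' ∉ sqBox a' (4 * ρ + 8) := by
    rintro a' ⟨a₀, ha₀, rfl⟩ c' ⟨c₀, hc₀, rfl⟩ hmem
    apply hsep a₀ ha₀ c₀ hc₀
    have : planarSwap c₀ ∈ planarSwap '' sqBox a₀ (4 * ρ + 8) := by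
      rw [image_planarSwap_sqBox]; exact hmem
    obtain ⟨w, hw, hww⟩ := this
    rwa [← planarSwap.injective hww]
  -- the planar crossing: in the transposed rectangle, `A` is on the left, `B` on the right,
  -- `C` on the bottom, `D` on the top
  have hcross : PlanarCrossing (planarSwap '' T.S) (planarSwap '' T.A) (planarSwap '' T.B)
      (planarSwap '' T.C) Dd := by
    refine PlanarCrossing.of_image (g := planarSwap) hswap ?_
    rw [hinv, hinv, hinv, hinv]
    refine planarCrossing_rect (a := c) (b := d) (c := a) (d := b) ?_ (fun z hz => hz.2) ?_ ?_
    · rintro z ⟨w, hw, rfl⟩; simpa using (hA w hw).2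
    · rintro z ⟨w, hw, rfl⟩; simpa using (hC w hw).2
    · rintro z ⟨w, hw, rfl⟩; simpa using hDd w hw
  have h := glueLinear_image T planarSwap hswap hk hρ hsep' hcross p hp0 hp1
  rw [hS, hA', hB', hC'] at h
  exact h

/-- **GL0, linear regime, target a SEGMENT of the top side**: in `S = [a,b] × [c,d]` with
`B = [x₁, x₂] × {d}` (`x₁ < x₂`), `A` on the bottom side, `C` on the left side, `D` on the right
side, `dist*(A, C) > 4ρ + 8`, `ρ ≥ 4`: `P_p[A ⟷^S B] · P_p[C ⟷^S D] ≤ (1 + λ^s) · P_p[C ⟷^S A]`.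
[cite: NewmanTassionWu2017, §3.2 (Theorem 3.6 with Remark 3); §3.3] -/
theorem glueLinear_seg_top {a b c d x₁ x₂ : ℤ} (hab : a + 3 ≤ b) (hcd : c + 3 ≤ d)
    (hx₁ : a ≤ x₁) (hx : x₁ < x₂) (hx₂ : x₂ ≤ b) {A C Dd : Set (ℤ × ℤ)}
    (hA : ∀ z ∈ A, z ∈ boxR a b c d ∧ z.2 = c) (hC : ∀ z ∈ C, z ∈ boxR a b c d ∧ z.1 = a)
    (hDd : ∀ z ∈ Dd, z.1 = b) (hk : 1 ≤ k) {ρ : ℕ} (hρ : 4 ≤ ρ)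
    (hsep : ∀ a' ∈ A, ∀ c' ∈ C, c' ∉ sqBox a' (4 * ρ + 8))
    (p : unitInterval) (hp0 : 0 < (p : ℝ)) (hp1 : (p : ℝ) < 1) :
    (bondPercolation (slabGraph 3 k) p).real
        (slabConn k (boxR a b c d) A {z | z.2 = d ∧ x₁ ≤ z.1 ∧ z.1 ≤ x₂}) *
        (bondPercolation (slabGraph 3 k) p).real (slabConn k (boxR a b c d) C Dd) ≤
      (1 + (2 / min (p : ℝ) (1 - p)) ^ (3 * ((5 * k + 4) * (2 * (2 * (3 * ρ + 3)) + 1) ^ 2))) *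
        (bondPercolation (slabGraph 3 k) p).real (slabConn k (boxR a b c d) C A) := by
  let T : SegSetup :=
    { a := c, b := d, c := a, d := b, y₁ := x₁, y₂ := x₂, A := planarSwap '' A, C := planarSwap '' C,
      hab := hcd, hcd := hab, hy₁ := hx₁, hy := hx, hy₂ := hx₂,
      hA := by
        rintro z ⟨w, hw, rfl⟩
        have := (hA w hw).1
        rw [mem_boxR_iff] at this ⊢
        simp only [planarSwap_apply, Prod.fst_swap, Prod.snd_swap]
        omega
      hC := by
        rintro z ⟨w, hw, rfl⟩
        have := (hC w hw).1
        rw [mem_boxR_iff] at this ⊢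
        simp only [planarSwap_apply, Prod.fst_swap, Prod.snd_swap]
        omega }
  have hswap : ∀ z w, planarAdj (planarSwap z) (planarSwap w) ↔ planarAdj z w := planarAdj_planarSwap
  have hinv : ∀ X : Set (ℤ × ℤ), planarSwap '' (planarSwap '' X) = X := by
    intro X; ext z
    simp only [Set.mem_image, planarSwap_apply]
    constructor
    · rintro ⟨w, ⟨v, hv, rfl⟩, rfl⟩; simpa using hv
    · intro hz; exact ⟨z.swap, ⟨z, hz, rfl⟩, by simp⟩
  have hS : planarSwap '' T.S = boxR a b c d := image_planarSwap_boxR _ _ _ _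
  have hA' : planarSwap '' T.A = A := hinv A
  have hC' : planarSwap '' T.C = C := hinv C
  have hB' : planarSwap '' T.B = {z | z.2 = d ∧ x₁ ≤ z.1 ∧ z.1 ≤ x₂} := by
    rw [image_planarSwap_eq]
    have hTB : T.B = {w | w.1 = d ∧ x₁ ≤ w.2 ∧ w.2 ≤ x₂} := rfl
    rw [hTB]
    ext z
    simp only [Set.mem_setOf_eq, Prod.fst_swap, Prod.snd_swap]
  have hsep' : ∀ a' ∈ T.A, ∀ c' ∈ T.C, c' ∉ sqBox a' (4 * ρ + 8) := by
    rintro a' ⟨a₀, ha₀, rfl⟩ c' ⟨c₀, hc₀, rfl⟩ hmem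
    apply hsep a₀ ha₀ c₀ hc₀
    have : planarSwap c₀ ∈ planarSwap '' sqBox a₀ (4 * ρ + 8) := by
      rw [image_planarSwap_sqBox]; exact hmem
    obtain ⟨w, hw, hww⟩ := this
    rwa [← planarSwap.injective hww]
  have hcross : PlanarCrossing (planarSwap '' T.S) (planarSwap '' T.A) (planarSwap '' T.B)
      (planarSwap '' T.C) Dd := by
    refine PlanarCrossing.of_image (g := planarSwap) hswap ?_
    rw [hinv, hinv, hinv, hinv]
    refine planarCrossing_rect (a := c) (b := d) (c := a) (d := b) ?_ (fun z hz => hz.1) ?_ ?_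
    · rintro z ⟨w, hw, rfl⟩; simpa using (hA w hw).2
    · rintro z ⟨w, hw, rfl⟩; simpa using (hC w hw).2
    · rintro z ⟨w, hw, rfl⟩; simpa using hDd w hw
  have h := glueLinear_seg_image T planarSwap hswap hk hρ hsep' hcross p hp0 hp1
  rw [hS, hA', hB', hC'] at h
  exact h

/-! ## The reflection: target on the left side -/

/-- The reflection `x ↦ a + b - x` maps the rectangle `[a,b] × [c,d]` to itself.
[cite: NewmanTassionWu2017, §3.3 ("Invariance under reflection")] -/
theorem image_planarReflect_boxR (a b c d : ℤ) : planarReflect (a + b) '' boxR a b c d = boxR a b c d := by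
  ext z
  simp only [Set.mem_image, planarReflect_apply, mem_boxR_iff]
  constructor
  · rintro ⟨w, hw, rfl⟩
    dsimp only
    omega
  · intro hz
    refine ⟨(a + b - z.1, z.2), by dsimp only; omega, ?_⟩
    ext <;> simp

/-- The reflection as a membership condition. [cite: NewmanTassionWu2017, §3.3 ("Invariance under reflection")] -/
theorem image_planarReflect_eq (t : ℤ) (X : Set (ℤ × ℤ)) : planarReflect t '' X = {z | (t - z.1, z.2) ∈ X} := by
  ext z
  simp only [Set.mem_image, planarReflect_apply, Set.mem_setOf_eq]
  constructor
  · rintro ⟨w, hw, rfl⟩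
    simpa using hw
  · intro hz
    exact ⟨(t - z.1, z.2), hz, by ext <;> simp⟩

/-- The reflection is an involution on sets. [cite: NewmanTassionWu2017, §3.3 ("Invariance under reflection")] -/
theorem image_planarReflect_image (t : ℤ) (X : Set (ℤ × ℤ)) :
    planarReflect t '' (planarReflect t '' X) = X := by
  ext z
  simp only [Set.mem_image, planarReflect_apply]
  constructor
  · rintro ⟨w, ⟨v, hv, rfl⟩, rfl⟩
    simpa using hv
  · intro hz
    exact ⟨(t - z.1, z.2), ⟨z, hz, rfl⟩, by ext <;> simp⟩

/-- **GL0, linear regime, target the full LEFT side**: in `S = [a,b] × [c,d]` with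
`B = {a} × [c,d]`, `A` on the right side, `C` on the bottom side and `D` on the top side,
`dist*(A, C) > 4ρ + 8`: `P_p[A ⟷^S B] · P_p[C ⟷^S D] ≤ (1 + λ^s) · P_p[C ⟷^S A]`.
[cite: NewmanTassionWu2017, §3.2 (Theorem 3.6 with Remark 3); §3.3 ("by symmetry")] -/
theorem glueLinear_rect_left {a b c d : ℤ} (hab : a + 3 ≤ b) (hcd : c + 3 ≤ d) {A C Dd : Set (ℤ × ℤ)}
    (hA : ∀ z ∈ A, z ∈ boxR a b c d ∧ z.1 = b) (hC : ∀ z ∈ C, z ∈ boxR a b c d ∧ z.2 = c)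
    (hDd : ∀ z ∈ Dd, z.2 = d) (hk : 1 ≤ k) {ρ : ℕ} (hρ : 2 ≤ ρ)
    (hsep : ∀ a' ∈ A, ∀ c' ∈ C, c' ∉ sqBox a' (4 * ρ + 8))
    (p : unitInterval) (hp0 : 0 < (p : ℝ)) (hp1 : (p : ℝ) < 1) :
    (bondPercolation (slabGraph 3 k) p).real
        (slabConn k (boxR a b c d) A {z | z ∈ boxR a b c d ∧ z.1 = a}) *
        (bondPercolation (slabGraph 3 k) p).real (slabConn k (boxR a b c d) C Dd) ≤
      (1 + (2 / min (p : ℝ) (1 - p)) ^ (3 * ((5 * k + 4) * (2 * (6 * ρ + 4) + 1) ^ 2))) *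
        (bondPercolation (slabGraph 3 k) p).real (slabConn k (boxR a b c d) C A) := by
  set g := planarReflect (a + b) with hgdef
  have hg : ∀ z w, planarAdj (g z) (g w) ↔ planarAdj z w := planarAdj_planarReflect (a + b)
  let T : RectSetup :=
    { a := a, b := b, c := c, d := d, A := g '' A, C := g '' C, hab := hab, hcd := hcd,
      hA := by
        rintro z ⟨w, hw, rfl⟩
        have := (hA w hw).1
        rw [mem_boxR_iff] at this ⊢
        simp only [hgdef, planarReflect_apply]
        omega
      hC := by
        rintro z ⟨w, hw, rfl⟩
        have := (hC w hw).1
        rw [mem_boxR_iff] at this ⊢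
        simp only [hgdef, planarReflect_apply]
        omega
      hAB := by
        rintro z ⟨w, hw, rfl⟩
        have h1 := (hA w hw).1
        have h2 := (hA w hw).2
        rw [mem_boxR_iff] at h1
        simp only [hgdef, planarReflect_apply]
        omega }
  have hinv : ∀ X : Set (ℤ × ℤ), g '' (g '' X) = X := image_planarReflect_image (a + b)
  have hS : g '' T.S = boxR a b c d := image_planarReflect_boxR a b c d
  have hA' : g '' T.A = A := hinv A
  have hC' : g '' T.C = C := hinv C
  have hB' : g '' T.B = {z | z ∈ boxR a b c d ∧ z.1 = a} := by
    rw [hgdef, image_planarReflect_eq]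
    have hTB : T.B = {w | w ∈ boxR a b c d ∧ w.1 = b} := rfl
    rw [hTB]
    ext z
    simp only [Set.mem_setOf_eq, mem_boxR_iff]
    omega
  have hsep' : ∀ a' ∈ T.A, ∀ c' ∈ T.C, c' ∉ sqBox a' (4 * ρ + 8) := by
    rintro a' ⟨a₀, ha₀, rfl⟩ c' ⟨c₀, hc₀, rfl⟩ hmem
    apply hsep a₀ ha₀ c₀ hc₀
    have : g c₀ ∈ g '' sqBox a₀ (4 * ρ + 8) := by
      rw [hgdef, image_planarReflect_sqBox]; exact hmem
    obtain ⟨w, hw, hww⟩ := this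
    rwa [← g.injective hww]
  have hcross : PlanarCrossing (g '' T.S) (g '' T.A) (g '' T.B) (g '' T.C) Dd := by
    refine PlanarCrossing.of_image (g := g) hg ?_
    rw [hinv, hinv, hinv, hinv]
    refine planarCrossing_rect (a := a) (b := b) (c := c) (d := d) ?_ (fun z hz => hz.2) ?_ ?_
    · rintro z ⟨w, hw, rfl⟩
      have := (hA w hw).2
      simp only [hgdef, planarReflect_apply]; omega
    · rintro z ⟨w, hw, rfl⟩
      simpa [hgdef] using (hC w hw).2
    · rintro z ⟨w, hw, rfl⟩
      simpa [hgdef] using hDd w hw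
  have h := glueLinear_image T g hg hk hρ hsep' hcross p hp0 hp1
  rw [hS, hA', hB', hC'] at h
  exact h

/-- **GL0, linear regime, target a SEGMENT of the left side**: in `S = [a,b] × [c,d]` with
`B = {a} × [y₁, y₂]` (`y₁ < y₂`), `A` on the right side, `C` on the bottom side, `D` on the top
side, `dist*(A, C) > 4ρ + 8`, `ρ ≥ 4`.
[cite: NewmanTassionWu2017, §3.2 (Theorem 3.6 with Remark 3); §3.3 ("by symmetry")] -/
theorem glueLinear_seg_left {a b c d y₁ y₂ : ℤ} (hab : a + 3 ≤ b) (hcd : c + 3 ≤ d)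
    (hy₁ : c ≤ y₁) (hy : y₁ < y₂) (hy₂ : y₂ ≤ d) {A C Dd : Set (ℤ × ℤ)}
    (hA : ∀ z ∈ A, z ∈ boxR a b c d ∧ z.1 = b) (hC : ∀ z ∈ C, z ∈ boxR a b c d ∧ z.2 = c)
    (hDd : ∀ z ∈ Dd, z.2 = d) (hk : 1 ≤ k) {ρ : ℕ} (hρ : 4 ≤ ρ)
    (hsep : ∀ a' ∈ A, ∀ c' ∈ C, c' ∉ sqBox a' (4 * ρ + 8))
    (p : unitInterval) (hp0 : 0 < (p : ℝ)) (hp1 : (p : ℝ) < 1) :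
    (bondPercolation (slabGraph 3 k) p).real
        (slabConn k (boxR a b c d) A {z | z.1 = a ∧ y₁ ≤ z.2 ∧ z.2 ≤ y₂}) *
        (bondPercolation (slabGraph 3 k) p).real (slabConn k (boxR a b c d) C Dd) ≤
      (1 + (2 / min (p : ℝ) (1 - p)) ^ (3 * ((5 * k + 4) * (2 * (2 * (3 * ρ + 3)) + 1) ^ 2))) *
        (bondPercolation (slabGraph 3 k) p).real (slabConn k (boxR a b c d) C A) := by
  set g := planarReflect (a + b) with hgdef
  have hg : ∀ z w, planarAdj (g z) (g w) ↔ planarAdj z w := planarAdj_planarReflect (a + b)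
  let T : SegSetup :=
    { a := a, b := b, c := c, d := d, y₁ := y₁, y₂ := y₂, A := g '' A, C := g '' C,
      hab := hab, hcd := hcd, hy₁ := hy₁, hy := hy, hy₂ := hy₂,
      hA := by
        rintro z ⟨w, hw, rfl⟩
        have := (hA w hw).1
        rw [mem_boxR_iff] at this ⊢
        simp only [hgdef, planarReflect_apply]
        omega
      hC := by
        rintro z ⟨w, hw, rfl⟩
        have := (hC w hw).1
        rw [mem_boxR_iff] at this ⊢
        simp only [hgdef, planarReflect_apply]
        omega }
  have hinv : ∀ X : Set (ℤ × ℤ), g '' (g '' X) = X := image_planarReflect_image (a + b)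
  have hS : g '' T.S = boxR a b c d := image_planarReflect_boxR a b c d
  have hA' : g '' T.A = A := hinv A
  have hC' : g '' T.C = C := hinv C
  have hB' : g '' T.B = {z | z.1 = a ∧ y₁ ≤ z.2 ∧ z.2 ≤ y₂} := by
    rw [hgdef, image_planarReflect_eq]
    have hTB : T.B = {w | w.1 = b ∧ y₁ ≤ w.2 ∧ w.2 ≤ y₂} := rfl
    rw [hTB]
    ext z
    simp only [Set.mem_setOf_eq]
    omega
  have hsep' : ∀ a' ∈ T.A, ∀ c' ∈ T.C, c' ∉ sqBox a' (4 * ρ + 8) := by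
    rintro a' ⟨a₀, ha₀, rfl⟩ c' ⟨c₀, hc₀, rfl⟩ hmem
    apply hsep a₀ ha₀ c₀ hc₀
    have : g c₀ ∈ g '' sqBox a₀ (4 * ρ + 8) := by
      rw [hgdef, image_planarReflect_sqBox]; exact hmem
    obtain ⟨w, hw, hww⟩ := this
    rwa [← g.injective hww]
  have hcross : PlanarCrossing (g '' T.S) (g '' T.A) (g '' T.B) (g '' T.C) Dd := by
    refine PlanarCrossing.of_image (g := g) hg ?_
    rw [hinv, hinv, hinv, hinv]
    refine planarCrossing_rect (a := a) (b := b) (c := c) (d := d) ?_ (fun z hz => hz.1) ?_ ?_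
    · rintro z ⟨w, hw, rfl⟩
      have := (hA w hw).2
      simp only [hgdef, planarReflect_apply]; omega
    · rintro z ⟨w, hw, rfl⟩
      simpa [hgdef] using (hC w hw).2
    · rintro z ⟨w, hw, rfl⟩
      simpa [hgdef] using hDd w hw
  have h := glueLinear_seg_image T g hg hk hρ hsep' hcross p hp0 hp1
  rw [hS, hA', hB', hC'] at h
  exact h

/-! ## Reflection followed by the swap: target on the bottom side -/

/-- The symmetry `(x, y) ↦ (y, t - x)` (reflection in `x`, then the diagonal swap).
[cite: NewmanTassionWu2017, §3.3 ("by symmetry")] -/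
def reflectSwap (t : ℤ) : ℤ × ℤ ≃ ℤ × ℤ := (planarReflect t).trans planarSwap

/-- `reflectSwap t (x, y) = (y, t - x)`. [cite: NewmanTassionWu2017, §3.3 ("by symmetry")] -/
@[simp] theorem reflectSwap_apply (t : ℤ) (z : ℤ × ℤ) : reflectSwap t z = (z.2, t - z.1) := by
  simp [reflectSwap, planarReflect_apply]

/-- `reflectSwap` preserves planar adjacency. [cite: NewmanTassionWu2017, §3.3 ("by symmetry")] -/
theorem planarAdj_reflectSwap (t : ℤ) (z w : ℤ × ℤ) :
    planarAdj (reflectSwap t z) (reflectSwap t w) ↔ planarAdj z w := by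
  rw [reflectSwap, Equiv.trans_apply, Equiv.trans_apply, planarAdj_planarSwap, planarAdj_planarReflect]

/-- `reflectSwap (a + b)` maps `[a,b] × [c,d]` to `[c,d] × [a,b]`. [cite: NewmanTassionWu2017, §3.3 ("by symmetry")] -/
theorem image_reflectSwap_boxR (a b c d : ℤ) : reflectSwap (a + b) '' boxR a b c d = boxR c d a b := by
  ext z
  simp only [Set.mem_image, reflectSwap_apply, mem_boxR_iff]
  constructor
  · rintro ⟨w, hw, rfl⟩
    dsimp only
    omega
  · intro hz
    refine ⟨(a + b - z.2, z.1), by dsimp only; omega, ?_⟩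
    ext <;> simp

/-- `reflectSwap` as a membership condition. [cite: NewmanTassionWu2017, §3.3 ("by symmetry")] -/
theorem image_reflectSwap_eq (t : ℤ) (X : Set (ℤ × ℤ)) : reflectSwap t '' X = {z | (t - z.2, z.1) ∈ X} := by
  ext z
  simp only [Set.mem_image, reflectSwap_apply, Set.mem_setOf_eq]
  constructor
  · rintro ⟨w, hw, rfl⟩
    simpa using hw
  · intro hz
    exact ⟨(t - z.2, z.1), hz, by ext <;> simp⟩

/-- Boxes are mapped to boxes by `reflectSwap`. [cite: NewmanTassionWu2017, §3.3 ("by symmetry")] -/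
theorem image_reflectSwap_sqBox (t : ℤ) (c : ℤ × ℤ) (n : ℕ) :
    reflectSwap t '' sqBox c n = sqBox (c.2, t - c.1) n := by
  rw [reflectSwap, Equiv.coe_trans, Set.image_comp, image_planarReflect_sqBox, image_planarSwap_sqBox]
  rfl

/-- **GL0, linear regime, target the full BOTTOM side**: in `S = [a,b] × [c,d]` with
`B = [a,b] × {c}`, `A` on the top side, `C` on the left side and `D` on the right side,
`dist*(A, C) > 4ρ + 8`: `P_p[A ⟷^S B] · P_p[C ⟷^S D] ≤ (1 + λ^s) · P_p[C ⟷^S A]`.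
[cite: NewmanTassionWu2017, §3.2 (Theorem 3.6 with Remark 3); §3.3 ("by symmetry")] -/
theorem glueLinear_rect_bottom {a b c d : ℤ} (hab : a + 3 ≤ b) (hcd : c + 3 ≤ d) {A C Dd : Set (ℤ × ℤ)}
    (hA : ∀ z ∈ A, z ∈ boxR a b c d ∧ z.2 = d) (hC : ∀ z ∈ C, z ∈ boxR a b c d ∧ z.1 = a)
    (hDd : ∀ z ∈ Dd, z.1 = b) (hk : 1 ≤ k) {ρ : ℕ} (hρ : 2 ≤ ρ)
    (hsep : ∀ a' ∈ A, ∀ c' ∈ C, c' ∉ sqBox a' (4 * ρ + 8))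
    (p : unitInterval) (hp0 : 0 < (p : ℝ)) (hp1 : (p : ℝ) < 1) :
    (bondPercolation (slabGraph 3 k) p).real
        (slabConn k (boxR a b c d) A {z | z ∈ boxR a b c d ∧ z.2 = c}) *
        (bondPercolation (slabGraph 3 k) p).real (slabConn k (boxR a b c d) C Dd) ≤
      (1 + (2 / min (p : ℝ) (1 - p)) ^ (3 * ((5 * k + 4) * (2 * (6 * ρ + 4) + 1) ^ 2))) *
        (bondPercolation (slabGraph 3 k) p).real (slabConn k (boxR a b c d) C A) := by
  -- the data in the box `[c,d] × [a,b]` with `B` its right side `{d} × [a,b]`, mapped by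
  -- `reflectSwap (c + d) : (x, y) ↦ (y, c + d - x)` onto `[a,b] × [c,d]` with `B ↦ [a,b] × {c}`
  set g := reflectSwap (c + d) with hgdef
  have hg : ∀ z w, planarAdj (g z) (g w) ↔ planarAdj z w := planarAdj_reflectSwap (c + d)
  have hgap : ∀ z, g z = (z.2, c + d - z.1) := fun z => by rw [hgdef, reflectSwap_apply]
  let T : RectSetup :=
    { a := c, b := d, c := a, d := b, A := g.symm '' A, C := g.symm '' C, hab := hcd, hcd := hab,
      hA := by
        rintro z ⟨w, hw, rfl⟩
        have h1 := (hA w hw).1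
        rw [mem_boxR_iff] at h1 ⊢
        have e : g (g.symm w) = w := g.apply_symm_apply w
        rw [hgap] at e
        have e1 := congrArg Prod.fst e; have e2 := congrArg Prod.snd e
        simp only at e1 e2
        omega
      hC := by
        rintro z ⟨w, hw, rfl⟩
        have h1 := (hC w hw).1
        rw [mem_boxR_iff] at h1 ⊢
        have e : g (g.symm w) = w := g.apply_symm_apply w
        rw [hgap] at e
        have e1 := congrArg Prod.fst e; have e2 := congrArg Prod.snd e
        simp only at e1 e2
        omega
      hAB := by
        rintro z ⟨w, hw, rfl⟩
        have h1 := (hA w hw).2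
        have e : g (g.symm w) = w := g.apply_symm_apply w
        rw [hgap] at e
        have e2 := congrArg Prod.snd e
        simp only at e2
        omega }
  have hinv : ∀ X : Set (ℤ × ℤ), g '' (g.symm '' X) = X := by
    intro X; rw [← Set.image_comp]; simp
  have hS : g '' T.S = boxR a b c d := image_reflectSwap_boxR c d a b
  have hA' : g '' T.A = A := hinv A
  have hC' : g '' T.C = C := hinv C
  have hB' : g '' T.B = {z | z ∈ boxR a b c d ∧ z.2 = c} := by
    rw [hgdef, image_reflectSwap_eq]
    have hTB : T.B = {w | w ∈ boxR c d a b ∧ w.1 = d} := rfl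
    rw [hTB]
    ext z
    simp only [Set.mem_setOf_eq, mem_boxR_iff]
    omega
  have hsep' : ∀ a' ∈ T.A, ∀ c' ∈ T.C, c' ∉ sqBox a' (4 * ρ + 8) := by
    rintro a' ⟨a₀, ha₀, rfl⟩ c' ⟨c₀, hc₀, rfl⟩ hmem
    apply hsep a₀ ha₀ c₀ hc₀
    have h1 : g (g.symm c₀) ∈ g '' sqBox (g.symm a₀) (4 * ρ + 8) := Set.mem_image_of_mem _ hmem
    rw [g.apply_symm_apply, hgdef, image_reflectSwap_sqBox] at h1
    have e : reflectSwap (c + d) ((reflectSwap (c + d)).symm a₀) = a₀ := Equiv.apply_symm_apply _ a₀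
    rw [reflectSwap_apply] at e
    rwa [e] at h1
  have hcross : PlanarCrossing (g '' T.S) (g '' T.A) (g '' T.B) (g '' T.C) Dd := by
    rw [hS, hA', hB', hC']
    exact (planarCrossing_rect' (a := a) (b := b) (c := c) (d := d) (A := C) (B := Dd) (C := A)
      (D := {z | z ∈ boxR a b c d ∧ z.2 = c}) (fun z hz => (hC z hz).2) hDd (fun z hz => (hA z hz).2)
      (fun z hz => hz.2)).swap_pairs
  have h := glueLinear_image T g hg hk hρ hsep' hcross p hp0 hp1
  rw [hS, hA', hB', hC'] at h
  exact h

/-- **GL0, linear regime, target a SEGMENT of the bottom side**: in `S = [a,b] × [c,d]` with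
`B = [x₁, x₂] × {c}` (`x₁ < x₂`), `A` on the top side, `C` on the left side, `D` on the right side,
`dist*(A, C) > 4ρ + 8`, `ρ ≥ 4` — the shape of Proposition 3.9 (`X`, `Y` on the bottom side).
[cite: NewmanTassionWu2017, §3.2 (Theorem 3.6 with Remark 3); §3.3 (Proposition 3.9)] -/
theorem glueLinear_seg_bottom {a b c d x₁ x₂ : ℤ} (hab : a + 3 ≤ b) (hcd : c + 3 ≤ d)
    (hx₁ : a ≤ x₁) (hx : x₁ < x₂) (hx₂ : x₂ ≤ b) {A C Dd : Set (ℤ × ℤ)}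
    (hA : ∀ z ∈ A, z ∈ boxR a b c d ∧ z.2 = d) (hC : ∀ z ∈ C, z ∈ boxR a b c d ∧ z.1 = a)
    (hDd : ∀ z ∈ Dd, z.1 = b) (hk : 1 ≤ k) {ρ : ℕ} (hρ : 4 ≤ ρ)
    (hsep : ∀ a' ∈ A, ∀ c' ∈ C, c' ∉ sqBox a' (4 * ρ + 8))
    (p : unitInterval) (hp0 : 0 < (p : ℝ)) (hp1 : (p : ℝ) < 1) :
    (bondPercolation (slabGraph 3 k) p).real
        (slabConn k (boxR a b c d) A {z | z.2 = c ∧ x₁ ≤ z.1 ∧ z.1 ≤ x₂}) *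
        (bondPercolation (slabGraph 3 k) p).real (slabConn k (boxR a b c d) C Dd) ≤
      (1 + (2 / min (p : ℝ) (1 - p)) ^ (3 * ((5 * k + 4) * (2 * (2 * (3 * ρ + 3)) + 1) ^ 2))) *
        (bondPercolation (slabGraph 3 k) p).real (slabConn k (boxR a b c d) C A) := by
  set g := reflectSwap (c + d) with hgdef
  have hg : ∀ z w, planarAdj (g z) (g w) ↔ planarAdj z w := planarAdj_reflectSwap (c + d)
  have hgap : ∀ z, g z = (z.2, c + d - z.1) := fun z => by rw [hgdef, reflectSwap_apply]
  let T : SegSetup :=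
    { a := c, b := d, c := a, d := b, y₁ := x₁, y₂ := x₂, A := g.symm '' A, C := g.symm '' C,
      hab := hcd, hcd := hab, hy₁ := hx₁, hy := hx, hy₂ := hx₂,
      hA := by
        rintro z ⟨w, hw, rfl⟩
        have h1 := (hA w hw).1
        rw [mem_boxR_iff] at h1 ⊢
        have e : g (g.symm w) = w := g.apply_symm_apply w
        rw [hgap] at e
        have e1 := congrArg Prod.fst e; have e2 := congrArg Prod.snd e
        simp only at e1 e2
        omega
      hC := by
        rintro z ⟨w, hw, rfl⟩
        have h1 := (hC w hw).1
        rw [mem_boxR_iff] at h1 ⊢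
        have e : g (g.symm w) = w := g.apply_symm_apply w
        rw [hgap] at e
        have e1 := congrArg Prod.fst e; have e2 := congrArg Prod.snd e
        simp only at e1 e2
        omega }
  have hinv : ∀ X : Set (ℤ × ℤ), g '' (g.symm '' X) = X := by
    intro X; rw [← Set.image_comp]; simp
  have hS : g '' T.S = boxR a b c d := image_reflectSwap_boxR c d a b
  have hA' : g '' T.A = A := hinv A
  have hC' : g '' T.C = C := hinv C
  have hB' : g '' T.B = {z | z.2 = c ∧ x₁ ≤ z.1 ∧ z.1 ≤ x₂} := by
    rw [hgdef, image_reflectSwap_eq]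
    have hTB : T.B = {w | w.1 = d ∧ x₁ ≤ w.2 ∧ w.2 ≤ x₂} := rfl
    rw [hTB]
    ext z
    simp only [Set.mem_setOf_eq]
    omega
  have hsep' : ∀ a' ∈ T.A, ∀ c' ∈ T.C, c' ∉ sqBox a' (4 * ρ + 8) := by
    rintro a' ⟨a₀, ha₀, rfl⟩ c' ⟨c₀, hc₀, rfl⟩ hmem
    apply hsep a₀ ha₀ c₀ hc₀
    have h1 : g (g.symm c₀) ∈ g '' sqBox (g.symm a₀) (4 * ρ + 8) := Set.mem_image_of_mem _ hmem
    rw [g.apply_symm_apply, hgdef, image_reflectSwap_sqBox] at h1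
    have e : reflectSwap (c + d) ((reflectSwap (c + d)).symm a₀) = a₀ := Equiv.apply_symm_apply _ a₀
    rw [reflectSwap_apply] at e
    rwa [e] at h1
  have hcross : PlanarCrossing (g '' T.S) (g '' T.A) (g '' T.B) (g '' T.C) Dd := by
    rw [hS, hA', hB', hC']
    exact (planarCrossing_rect' (a := a) (b := b) (c := c) (d := d) (A := C) (B := Dd) (C := A)
      (D := {z | z.2 = c ∧ x₁ ≤ z.1 ∧ z.1 ≤ x₂}) (fun z hz => (hC z hz).2) hDd (fun z hz => (hA z hz).2)
      (fun z hz => hz.1)).swap_pairs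
  have h := glueLinear_seg_image T g hg hk hρ hsep' hcross p hp0 hp1
  rw [hS, hA', hB', hC'] at h
  exact h

end NTW17

end Literature.Probability.Percolation
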